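import Summits.BirchSwinnertonDyer.BirchSwinnertonDyer.Theorems.ByReductionTypeAtTwoMultTowerNS2OneBitHolds
import HarnessLib

/-!
# Route `ByReductionTypeAtTwo`, crux `MultUpperHalfAtTwo` (item stmt-BirchSwinnertonDyer-19922), TOWER road, NON-SPLIT rows:
# TWO BITS at EVERY non-split multiplicative `2`, part 1 — the count «among five `2`-torsion coinvariant classes two coincide», no Tate unit

HONEST FRAMING (cell `bsd-2adic`, run/shared/lean/pub/bsd-2adic/, seat `bsd-2adic-tower-1` GEN 10, HUMAN RULINGS
D-0036 / D-0054 / D-0074): theorems only (no definition, no named fact, no `sorry`); closes no item by itself; nothing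
booked; BSD is not proved by any of this. The two-bit NON-SPLIT tower doors (`MultTowerCert.towerGapAtTwo_of_layerSelmer_cert_nonsplitTwo`
and kin, `C₂ = 4`) display the PRINT binder `hNS2 = Greenberg1999.sec3_natCard_localTowerKerPrimary_le_four_nonsplitMultiplicative_two`
(Greenberg, LNM 1716, §3 p. 93: `|ker(r_{v_n})| ∼ 2c_v ≤ 4`) through its `2`-torsion projection
(`MultTowerCert.atTwo_le_four_of_nonsplit`). This file proves that PROJECTION — `𝒦_{v,n}[2^∞][2]` finite of order `≤ 4` at
every non-split multiplicative `2`, every layer `n`, WITHOUT the Tate-unit hypothesis of the one-bit theorem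
`localTowerKerTwoTorsion_le_two_nonsplitTwo_of_tateUnit_holds` (GEN 9) — by re-running GEN 9's count with five classes
instead of three: in BRICK 16d `exists_div_eq_zpow_mul_coboundary_of_three` the Tate unit `≡ ±3 (mod 8)` enters ONLY through
BRICK 16c (`false_of_odd_exponent_of_sq_eq`: no odd exponent in CASE A); dropping it, the exponent parity
`x ↦ a(x) mod 2` (`τ₀x·x = q^{a(x)}`) survives as the only obstruction, and

* `exists_div_eq_zpow_mul_coboundary_of_three_even` — among three `2`-torsion elements of `T` of EVEN exponent two are
  congruent modulo `B = q^ℤ·(g−1)T` (CASE A: BRICK 16b coboundaries + the class field input `hN2` on the three norms + C7;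
  CASE B: C6 on a quotient) — no Tate unit;
* `div_twoTorsion_data` — bookkeeping: the quotient `x/x'` of two `2`-torsion data is a `2`-torsion datum with exponent `a − a'`;
* `exists_div_eq_zpow_mul_coboundary_of_five` — among FIVE `2`-torsion elements two are congruent (three share an exponent
  parity; divide by one of them);
* (part 2, `…MultTowerNS2TwoBit.lean`) `twoTorsion_localTowerKerPrimary_le_four_nonsplitTwo` — `#𝒦_{v,n}[2^∞][2] ≤ 4` for `W/ℚ` globally
  minimal, multiplicative NON-SPLIT at `2`, `κ` cyclotomic, `v ∋ 2`, every `n` (assembly as `…MultTowerNS2OneBitHolds.lean` with `Fin 5`).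

Optimality: for Tate unit `≡ ±1 (mod 8)` the `2`-torsion IS `(ℤ/2)²` (cell memo PROOF-NS2ONE.md §5), so `4` is sharp in general.
References: R. Greenberg, LNM 1716 (1999), §3 pp. 85–93; J. Silverman, GTM 151, V.3–V.5; J. Neukirch, *ANT* V (1.1);
cell memos PROOF-NS2ONE.md, SCOPE-hNS2one-kernel-GEN8.md.
-/

set_option autoImplicit false
-- the Theorems namespace of this sub repeats the summit name by design (D-0017 nested layout: Summit.<S>.<Sub>)
set_option linter.dupNamespace false

noncomputable section

open scoped Classical IntermediateField

namespace Summit.BirchSwinnertonDyer.BirchSwinnertonDyer.Theorems.MultTowerNS2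

open NumberField IsDedekindDomain Field WeierstrassCurve PadicInt Rat.HeightOneSpectrum
  Literature.NumberTheory.EllipticCurves Literature.NumberTheory.EllipticCurves.ResKernel
  Literature.NumberTheory.GaloisRepresentations

variable {κ : ZpExtension ℚ 2}

/-! ### Among three EVEN-exponent `2`-torsion elements two are congruent (no Tate unit) -/

/-- **No three pairwise incongruent `2`-torsion elements of EVEN exponent** (setting of BRICKs 15/16; `g` a topological
generator of `H_n` modulo `H_∞` fixing `t`; `τ₀ ∈ H_∞` a flip; `hN2` the class field input for the quadratic layer in «three
elements, two congruent» form; NO hypothesis on the Tate unit): among any three `x₀, x₁, x₂ ∈ T` with `τ₀x_i·x_i = Q^{2c_i}` and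
`x_i² ∈ B = q^ℤ·(g−1)T`, two are congruent modulo `B`. CASE A (some `f₀` with `N_σ f₀ = q`): normalise, write
`x_i' = gy_i/y_i` (BRICK 16b), apply `hN2` to the norms `y_i·τ₀y_i`, conclude by C7 — BRICK 16d's CASE A without its first
step. CASE B: C6 on the quotient `x₀/x₁`. [cite: GreenbergLNM1716, §3 (pp. 87–93)] -/
theorem exists_div_eq_zpow_mul_coboundary_of_three_even (v : HeightOneSpectrum (𝓞 ℚ)) (n : ℕ)
    {g : absoluteGaloisGroup (v.adicCompletion ℚ)} {ug : ℤ_[2]ˣ}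
    (hug : ((κ (resGal (K := ℚ) (v.adicCompletion ℚ) g)).toAdd : ℤ_[2]) = 2 ^ n * (ug : ℤ_[2]))
    (hgn : g ∈ localSubgroup (κ.layerSubgroup n) (v.adicCompletion ℚ))
    {t : AlgebraicClosure (v.adicCompletion ℚ)}
    (ht : ∀ σ : absoluteGaloisGroup (v.adicCompletion ℚ), σ • t = t ∨ σ • t = -t) (hgt : g • t = t)
    {τ₀ : absoluteGaloisGroup (v.adicCompletion ℚ)} (hτ₀ : τ₀ ∈ localSubgroup κ.kerSubgroup (v.adicCompletion ℚ))
    (hτ₀t : τ₀ • t = -t) {Q : AlgebraicClosure (v.adicCompletion ℚ)}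
    (hQfix : ∀ σ : absoluteGaloisGroup (v.adicCompletion ℚ), σ • Q = Q) (hQ0 : Q ≠ 0)
    (hQtor : ∀ j : ℤ, Q ^ j = 1 → j = 0)
    (hN2 : ∀ c₁ c₂ c₃ : AlgebraicClosure (v.adicCompletion ℚ), c₁ ≠ 0 → c₂ ≠ 0 → c₃ ≠ 0 →
      (∀ h ∈ localSubgroup (κ.layerSubgroup n) (v.adicCompletion ℚ), h • c₁ = c₁) →
      (∀ h ∈ localSubgroup (κ.layerSubgroup n) (v.adicCompletion ℚ), h • c₂ = c₂) →
      (∀ h ∈ localSubgroup (κ.layerSubgroup n) (v.adicCompletion ℚ), h • c₃ = c₃) →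
      ∃ f₀ : AlgebraicClosure (v.adicCompletion ℚ), f₀ ≠ 0 ∧
        (∀ h ∈ localSubgroup (κ.layerSubgroup n) (v.adicCompletion ℚ), h • t = t → h • f₀ = f₀) ∧
        (c₁ = f₀ * τ₀ • f₀ * c₂ ∨ c₁ = f₀ * τ₀ • f₀ * c₃ ∨ c₂ = f₀ * τ₀ • f₀ * c₃))
    {x z : Fin 3 → AlgebraicClosure (v.adicCompletion ℚ)} {c j jz : Fin 3 → ℤ} (hx0 : ∀ i, x i ≠ 0)
    (hxL : ∀ i, ∀ h ∈ localSubgroup κ.kerSubgroup (v.adicCompletion ℚ), h • t = t → h • x i = x i)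
    (hxc : ∀ i, τ₀ • x i * x i = Q ^ (2 * c i)) (hz0 : ∀ i, z i ≠ 0)
    (hzL : ∀ i, ∀ h ∈ localSubgroup κ.kerSubgroup (v.adicCompletion ℚ), h • t = t → h • z i = z i)
    (hzj : ∀ i, τ₀ • z i * z i = Q ^ jz i) (hx2 : ∀ i, x i ^ 2 = Q ^ j i * (g • z i / z i)) :
    ∃ i i' : Fin 3, i ≠ i' ∧ ∃ (c' : ℤ) (w : AlgebraicClosure (v.adicCompletion ℚ)), w ≠ 0 ∧
      (∀ h ∈ localSubgroup κ.kerSubgroup (v.adicCompletion ℚ), h • t = t → h • w = w) ∧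
      (∃ jw : ℤ, τ₀ • w * w = Q ^ jw) ∧ x i / x i' = Q ^ c' * (g • w / w) := by
  by_cases hA : ∃ f₀ : AlgebraicClosure (v.adicCompletion ℚ), f₀ ≠ 0 ∧
      (∀ h ∈ localSubgroup (κ.layerSubgroup n) (v.adicCompletion ℚ), h • t = t → h • f₀ = f₀) ∧ τ₀ • f₀ * f₀ = Q
  · -- CASE A: normalise and write each `x_i Q^{-c_i}` as a coboundary `g y_i / y_i` (BRICK 16b)
    have hcob : ∀ i, ∃ y : AlgebraicClosure (v.adicCompletion ℚ), y ≠ 0 ∧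
        (∀ h ∈ localSubgroup κ.kerSubgroup (v.adicCompletion ℚ), h • t = t → h • y = y) ∧
        x i * (Q ^ c i)⁻¹ = g • y / y ∧ y * τ₀ • y ≠ 0 ∧
        ∀ h ∈ localSubgroup (κ.layerSubgroup n) (v.adicCompletion ℚ), h • (y * τ₀ • y) = y * τ₀ • y := fun i ↦ by
      obtain ⟨hx'L, hx'U, hx'2⟩ := smul_mul_zpow_inv (κ := κ) v hQfix hQ0 (hxL i) (hxc i) (hx2 i)
      exact exists_coboundary_of_sq_eq (κ := κ) v n hug ht hgt hτ₀ hτ₀t hQfix hQ0 hQtor hx'L hx'U (hz0 i) (hzL i)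
        (hzj i) hx'2
    choose y hy0 hyL hxy hN0 hNn using hcob
    -- the class field input on the three norms
    obtain ⟨f, hf0, hfM, hcases⟩ := hN2 (y 0 * τ₀ • y 0) (y 1 * τ₀ • y 1) (y 2 * τ₀ • y 2) (hN0 0) (hN0 1) (hN0 2)
      (hNn 0) (hNn 1) (hNn 2)
    obtain ⟨i, i', hii', hrel⟩ : ∃ i i' : Fin 3, i ≠ i' ∧ y i * τ₀ • y i = f * τ₀ • f * (y i' * τ₀ • y i') := by
      rcases hcases with h | h | h
      exacts [⟨0, 1, by decide, h⟩, ⟨0, 2, by decide, h⟩, ⟨1, 2, by decide, h⟩]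
    have hrel' : y i * τ₀ • y i = Q ^ (0 : ℤ) * (f * τ₀ • f) * (y i' * τ₀ • y i') := by
      rw [zpow_zero, one_mul]; exact hrel
    -- C7
    obtain ⟨hw0, hwL, hwε, hww⟩ :=
      div_coboundary_eq_of_norm_rel (κ := κ) v n hgn hgt (hy0 i) (hy0 i') hf0 (hyL i) (hyL i') hfM hrel'
    refine ⟨i, i', hii', c i - c i', y i / (y i' * f), hw0, hwL, ⟨0, hwε⟩, ?_⟩
    have hQci : Q ^ c i ≠ 0 := zpow_ne_zero _ hQ0
    have hQci' : Q ^ c i' ≠ 0 := zpow_ne_zero _ hQ0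
    have hxi' := hx0 i'
    rw [← hww, ← hxy i, ← hxy i', zpow_sub₀ hQ0]
    field_simp
  · -- CASE B: C6 applies to the quotient `x₀ / x₁` (even exponent `2(c₀ − c₁)`)
    push Not at hA
    have hτx0 : τ₀ • x 1 ≠ 0 := (smul_ne_zero_iff_ne τ₀).mpr (hx0 1)
    have hτz0 : τ₀ • z 1 ≠ 0 := (smul_ne_zero_iff_ne τ₀).mpr (hz0 1)
    have hgz0 : g • z 1 ≠ 0 := (smul_ne_zero_iff_ne g).mpr (hz0 1)
    have hτx1 : τ₀ • x 1 * x 1 ≠ 0 := by rw [hxc 1]; exact zpow_ne_zero _ hQ0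
    have hτz1 : τ₀ • z 1 * z 1 ≠ 0 := by rw [hzj 1]; exact zpow_ne_zero _ hQ0
    have hX0 : x 0 / x 1 ≠ 0 := div_ne_zero (hx0 0) (hx0 1)
    have hXL : ∀ h ∈ localSubgroup κ.kerSubgroup (v.adicCompletion ℚ), h • t = t → h • (x 0 / x 1) = x 0 / x 1 :=
      fun h hh hht ↦ by rw [smul_div₀', hxL 0 h hh hht, hxL 1 h hh hht]
    have hXc : τ₀ • (x 0 / x 1) * (x 0 / x 1) = Q ^ (2 * (c 0 - c 1)) := by
      rw [mul_sub, zpow_sub₀ hQ0, ← hxc 0, ← hxc 1, smul_div₀']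
      field_simp
    have hZ0 : z 0 / z 1 ≠ 0 := div_ne_zero (hz0 0) (hz0 1)
    have hZL : ∀ h ∈ localSubgroup κ.kerSubgroup (v.adicCompletion ℚ), h • t = t → h • (z 0 / z 1) = z 0 / z 1 :=
      fun h hh hht ↦ by rw [smul_div₀', hzL 0 h hh hht, hzL 1 h hh hht]
    have hZj : τ₀ • (z 0 / z 1) * (z 0 / z 1) = Q ^ (jz 0 - jz 1) := by
      rw [zpow_sub₀ hQ0, ← hzj 0, ← hzj 1, smul_div₀']
      field_simp
    have hX2 : (x 0 / x 1) ^ 2 = Q ^ (j 0 - j 1) * (g • (z 0 / z 1) / (z 0 / z 1)) := by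
      rw [div_pow, hx2 0, hx2 1, zpow_sub₀ hQ0, smul_div₀']
      field_simp
    obtain ⟨c', w, hw0, hwL, hwj, hxw⟩ := exists_eq_zpow_mul_coboundary_of_even (κ := κ) v n hug hgn ht hgt hτ₀ hτ₀t
      hQfix hQ0 hQtor hA hN2 hX0 hXL hXc hZ0 hZL hZj hX2
    exact ⟨0, 1, by decide, c', w, hw0, hwL, hwj, hxw⟩

/-! ### Among FIVE `2`-torsion elements two are congruent -/

/-- **Quotient of two `2`-torsion data.** If `x, x'` are `H_∞ ∩ Stab(t)`-invariant with `τ₀x·x = Q^a`, `τ₀x'·x' = Q^{a'}`,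
`x² = Q^j·gz/z`, `x'² = Q^{j'}·gz'/z'` (`z, z' ∈ T` with exponents `jz, jz'`), then `X = x/x'`, `Z = z/z'` satisfy the same with
exponents `a − a'`, `j − j'`, `jz − jz'`. [folklore] -/
theorem div_twoTorsion_data (v : HeightOneSpectrum (𝓞 ℚ)) {g τ₀ : absoluteGaloisGroup (v.adicCompletion ℚ)}
    {t Q : AlgebraicClosure (v.adicCompletion ℚ)} (hQ0 : Q ≠ 0)
    {x x' z z' : AlgebraicClosure (v.adicCompletion ℚ)} {a a' j j' jz jz' : ℤ} (hx0 : x ≠ 0) (hx'0 : x' ≠ 0)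
    (hxL : ∀ h ∈ localSubgroup κ.kerSubgroup (v.adicCompletion ℚ), h • t = t → h • x = x)
    (hx'L : ∀ h ∈ localSubgroup κ.kerSubgroup (v.adicCompletion ℚ), h • t = t → h • x' = x')
    (hxa : τ₀ • x * x = Q ^ a) (hx'a : τ₀ • x' * x' = Q ^ a') (hz0 : z ≠ 0) (hz'0 : z' ≠ 0)
    (hzL : ∀ h ∈ localSubgroup κ.kerSubgroup (v.adicCompletion ℚ), h • t = t → h • z = z)
    (hz'L : ∀ h ∈ localSubgroup κ.kerSubgroup (v.adicCompletion ℚ), h • t = t → h • z' = z')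
    (hzj : τ₀ • z * z = Q ^ jz) (hz'j : τ₀ • z' * z' = Q ^ jz')
    (hx2 : x ^ 2 = Q ^ j * (g • z / z)) (hx'2 : x' ^ 2 = Q ^ j' * (g • z' / z')) :
    x / x' ≠ 0 ∧ (∀ h ∈ localSubgroup κ.kerSubgroup (v.adicCompletion ℚ), h • t = t → h • (x / x') = x / x') ∧
      τ₀ • (x / x') * (x / x') = Q ^ (a - a') ∧ z / z' ≠ 0 ∧
      (∀ h ∈ localSubgroup κ.kerSubgroup (v.adicCompletion ℚ), h • t = t → h • (z / z') = z / z') ∧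
      τ₀ • (z / z') * (z / z') = Q ^ (jz - jz') ∧ (x / x') ^ 2 = Q ^ (j - j') * (g • (z / z') / (z / z')) := by
  have hτx0 : τ₀ • x' ≠ 0 := (smul_ne_zero_iff_ne τ₀).mpr hx'0
  have hτz0 : τ₀ • z' ≠ 0 := (smul_ne_zero_iff_ne τ₀).mpr hz'0
  have hgz0 : g • z' ≠ 0 := (smul_ne_zero_iff_ne g).mpr hz'0
  have hτx1 : τ₀ • x' * x' ≠ 0 := by rw [hx'a]; exact zpow_ne_zero _ hQ0
  have hτz1 : τ₀ • z' * z' ≠ 0 := by rw [hz'j]; exact zpow_ne_zero _ hQ0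
  refine ⟨div_ne_zero hx0 hx'0, fun h hh hht ↦ by rw [smul_div₀', hxL h hh hht, hx'L h hh hht], ?_,
    div_ne_zero hz0 hz'0, fun h hh hht ↦ by rw [smul_div₀', hzL h hh hht, hz'L h hh hht], ?_, ?_⟩
  · rw [zpow_sub₀ hQ0, ← hxa, ← hx'a, smul_div₀']
    field_simp
  · rw [zpow_sub₀ hQ0, ← hzj, ← hz'j, smul_div₀']
    field_simp
  · rw [div_pow, hx2, hx'2, zpow_sub₀ hQ0, smul_div₀']
    field_simp

/-- **MAIN (no Tate unit): no five pairwise incongruent `2`-torsion coinvariant classes.** In the setting of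
`exists_div_eq_zpow_mul_coboundary_of_three_even`, among any five `x₀, …, x₄ ∈ T` whose squares lie in `B = q^ℤ·(g−1)T`, two are
congruent modulo `B`: three of them have exponents `a_i` of the same parity (pigeonhole), and dividing by one of these gives
three EVEN-exponent data (`div_twoTorsion_data`), to which the three-even lemma applies. Hence the `2`-torsion of
`E(ℚ_{2,∞})/(g−1)` has at most `4` elements (assembly below). [cite: GreenbergLNM1716, §3 (pp. 87–93)] -/
theorem exists_div_eq_zpow_mul_coboundary_of_five (v : HeightOneSpectrum (𝓞 ℚ)) (n : ℕ)
    {g : absoluteGaloisGroup (v.adicCompletion ℚ)} {ug : ℤ_[2]ˣ}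
    (hug : ((κ (resGal (K := ℚ) (v.adicCompletion ℚ) g)).toAdd : ℤ_[2]) = 2 ^ n * (ug : ℤ_[2]))
    (hgn : g ∈ localSubgroup (κ.layerSubgroup n) (v.adicCompletion ℚ))
    {t : AlgebraicClosure (v.adicCompletion ℚ)}
    (ht : ∀ σ : absoluteGaloisGroup (v.adicCompletion ℚ), σ • t = t ∨ σ • t = -t) (hgt : g • t = t)
    {τ₀ : absoluteGaloisGroup (v.adicCompletion ℚ)} (hτ₀ : τ₀ ∈ localSubgroup κ.kerSubgroup (v.adicCompletion ℚ))
    (hτ₀t : τ₀ • t = -t) {Q : AlgebraicClosure (v.adicCompletion ℚ)}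
    (hQfix : ∀ σ : absoluteGaloisGroup (v.adicCompletion ℚ), σ • Q = Q) (hQ0 : Q ≠ 0)
    (hQtor : ∀ j : ℤ, Q ^ j = 1 → j = 0)
    (hN2 : ∀ c₁ c₂ c₃ : AlgebraicClosure (v.adicCompletion ℚ), c₁ ≠ 0 → c₂ ≠ 0 → c₃ ≠ 0 →
      (∀ h ∈ localSubgroup (κ.layerSubgroup n) (v.adicCompletion ℚ), h • c₁ = c₁) →
      (∀ h ∈ localSubgroup (κ.layerSubgroup n) (v.adicCompletion ℚ), h • c₂ = c₂) →
      (∀ h ∈ localSubgroup (κ.layerSubgroup n) (v.adicCompletion ℚ), h • c₃ = c₃) →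
      ∃ f₀ : AlgebraicClosure (v.adicCompletion ℚ), f₀ ≠ 0 ∧
        (∀ h ∈ localSubgroup (κ.layerSubgroup n) (v.adicCompletion ℚ), h • t = t → h • f₀ = f₀) ∧
        (c₁ = f₀ * τ₀ • f₀ * c₂ ∨ c₁ = f₀ * τ₀ • f₀ * c₃ ∨ c₂ = f₀ * τ₀ • f₀ * c₃))
    {x z : Fin 5 → AlgebraicClosure (v.adicCompletion ℚ)} {a j jz : Fin 5 → ℤ} (hx0 : ∀ i, x i ≠ 0)
    (hxL : ∀ i, ∀ h ∈ localSubgroup κ.kerSubgroup (v.adicCompletion ℚ), h • t = t → h • x i = x i)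
    (hxa : ∀ i, τ₀ • x i * x i = Q ^ a i) (hz0 : ∀ i, z i ≠ 0)
    (hzL : ∀ i, ∀ h ∈ localSubgroup κ.kerSubgroup (v.adicCompletion ℚ), h • t = t → h • z i = z i)
    (hzj : ∀ i, τ₀ • z i * z i = Q ^ jz i) (hx2 : ∀ i, x i ^ 2 = Q ^ j i * (g • z i / z i)) :
    ∃ i i' : Fin 5, i ≠ i' ∧ ∃ (c' : ℤ) (w : AlgebraicClosure (v.adicCompletion ℚ)), w ≠ 0 ∧
      (∀ h ∈ localSubgroup κ.kerSubgroup (v.adicCompletion ℚ), h • t = t → h • w = w) ∧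
      (∃ jw : ℤ, τ₀ • w * w = Q ^ jw) ∧ x i / x i' = Q ^ c' * (g • w / w) := by
  -- three indices with exponents of the same parity
  obtain ⟨b, hb⟩ := Fintype.exists_lt_card_fiber_of_mul_lt_card (fun i : Fin 5 ↦ decide (Even (a i)))
    (n := 2) (by simp)
  have hs3 : 3 ≤ Fintype.card {i : Fin 5 // decide (Even (a i)) = b} := by
    rw [Fintype.card_subtype]; exact hb
  let emb : Fin 3 ↪ {i : Fin 5 // decide (Even (a i)) = b} :=
    (Fin.castLEEmb hs3).trans (Fintype.equivFin _).symm.toEmbedding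
  let e : Fin 3 → Fin 5 := fun m ↦ (emb m : Fin 5)
  have he_inj : Function.Injective e := fun m m' h ↦ emb.injective (Subtype.ext h)
  have hpar : ∀ m : Fin 3, decide (Even (a (e m))) = b := fun m ↦ (emb m).2
  set i₀ : Fin 5 := e 0 with hi₀
  -- exponents `a (e m) - a i₀` are even
  have heven : ∀ m : Fin 3, ∃ c : ℤ, a (e m) - a i₀ = 2 * c := by
    intro m
    have h1 : Even (a (e m)) ↔ Even (a i₀) := decide_eq_decide.mp ((hpar m).trans (hpar 0).symm)
    have h2 : Even (a (e m) - a i₀) := Int.even_sub.mpr h1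
    obtain ⟨r, hr⟩ := h2
    exact ⟨r, by rw [hr]; ring⟩
  choose c hc using heven
  -- the quotient data `y m = x (e m) / x i₀`
  have hdata := fun m : Fin 3 ↦ div_twoTorsion_data (κ := κ) v hQ0 (hx0 (e m)) (hx0 i₀) (hxL (e m)) (hxL i₀)
    (hxa (e m)) (hxa i₀) (hz0 (e m)) (hz0 i₀) (hzL (e m)) (hzL i₀) (hzj (e m)) (hzj i₀) (hx2 (e m)) (hx2 i₀)
  have hyc : ∀ m : Fin 3, τ₀ • (x (e m) / x i₀) * (x (e m) / x i₀) = Q ^ (2 * c m) := fun m ↦ by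
    rw [← hc m]; exact (hdata m).2.2.1
  obtain ⟨m, m', hmm', c', w, hw0, hwL, hwj, hxw⟩ :=
    exists_div_eq_zpow_mul_coboundary_of_three_even (κ := κ) v n hug hgn ht hgt hτ₀ hτ₀t hQfix hQ0 hQtor hN2
      (x := fun m ↦ x (e m) / x i₀) (z := fun m ↦ z (e m) / z i₀) (c := c) (j := fun m ↦ j (e m) - j i₀)
      (jz := fun m ↦ jz (e m) - jz i₀)
      (fun m ↦ (hdata m).1) (fun m ↦ (hdata m).2.1) hyc (fun m ↦ (hdata m).2.2.2.1) (fun m ↦ (hdata m).2.2.2.2.1)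
      (fun m ↦ (hdata m).2.2.2.2.2.1) (fun m ↦ (hdata m).2.2.2.2.2.2)
  refine ⟨e m, e m', fun h ↦ hmm' (he_inj h), c', w, hw0, hwL, hwj, ?_⟩
  have hxi₀ := hx0 i₀
  have hxm' := hx0 (e m')
  rw [← hxw]
  field_simp

end Summit.BirchSwinnertonDyer.BirchSwinnertonDyer.Theorems.MultTowerNS2

end
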